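import Summits.KontsevichZagierPeriods.KontsevichZagierPeriods.Theorems.HurwitzMicroSectorsNormalFormPrincipleLevelOne
import Summits.KontsevichZagierPeriods.KontsevichZagierPeriods.Theorems.HurwitzMicroSectorsNormalFormPrincipleSlabASubPtK20
import Summits.KontsevichZagierPeriods.KontsevichZagierPeriods.Theorems.HurwitzMicroSectorsNormalFormPrincipleAlgCarriers
import Summits.KontsevichZagierPeriods.KontsevichZagierPeriods.Theorems.HurwitzMicroSectorsNormalFormPrincipleM2FiveZetaTwo

/-!
# `NormalFormPrinciple` (stmt-KontsevichZagierPeriods-3869), line `SketchIdeator1` — leaf `stub_boxRigidity`: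
# level two with real-algebraic coefficients: the dimension-one endgame `Λ(2, γ) + [pt, q]`

Registered sub-goal `levelTwo_dimOne_normalForm` of the layer "Conjecture 1 for
`[(0,1)², P(x,y)/(1 − x²y²)]`, `P ∈ (ℚ̄ ∩ ℝ)[x,y]`" (lead file `…AlgLevelTwo`). For a real ALGEBRAIC
coefficient `c`, the dimension-one representation
`N₁ = [(0,1), (c/n) u^b (Σ_{i<n} u^i)/(1 + u)]` is brought to the normal form `Λ(2, γ) + [pt, q]`
(`γ, q` real algebraic, `Λ(2, γ) = [(1,2), γ/y]` the tree's dlog carrier) by three moves: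

1. division with remainder `u^b Σ_{i<n} u^i = (1 + u) s(u) + ρ` in `ℚ[u]` (`ρ` = the value at
   `u = −1`, `Polynomial.modByMonic_X_sub_C_eq_C_eval`) and integrand additivity (rule 1):
   `N₁ ≡ [(0,1), (c/n) s(u)] + [(0,1), (cρ/n)/(1 + u)]`;
2. the polynomial box is an algebraic POINT `[pt, (c/n)(S(1) − S(0))]`, `S' = s`, by ONE
   Newton–Leibniz move over the point with algebraic ends (`SlabAK20.slabA_sub_pt_mem_relations`,
   rule 3);
3. the shift `y = 1 + u` (rule 2, `AlgSplitK5.pole_neg_sub_carrier_mem_relations` at the pole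
   `ρ₀ = −1`) carries `[(0,1), γ/(1 + u)]` onto the carrier `[(1,2), γ/y]`, `γ = cρ/n`.

When `n = 2m` is even, `ρ = (−1)^b Σ_{i<2m} (−1)^i = 0` (`neg_one_geom_sum`): the carrier has the
zero integrand, is itself a relation (`Dlog.carrierA_zero_mem_relations`), and `N₁ ≡ [pt, q]`.

References: M. Kontsevich, D. Zagier, *Periods* (2001), §1.2 rules (1)–(3). No new definitions.
-/

noncomputable section

open MeasureTheory Set
open scoped Polynomial
open Literature.NumberTheory.Transcendental Literature.NumberTheory.Transcendental.KZ
open Literature.ModelTheory.ExponentialFields (IsSemialgebraic)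

namespace Summit.KontsevichZagierPeriods.HurwitzMicroSectors.NormalFormPrinciple.PiBox.AlgLevelTwo

/-! ### Algebra: division of `u^b Σ_{i<n} u^i` by `1 + u` -/

/-- Division with remainder by `X + 1`, read in `ℝ`: `p(u) = (u + 1)·(p /ₘ (X + 1))(u) + p(−1)`.
[folklore] -/
theorem lt2_aeval_eq_divByMonic (p : ℚ[X]) (u : ℝ) :
    (Polynomial.aeval u p : ℝ) =
      (u + 1) * (Polynomial.aeval u (p /ₘ (Polynomial.X + 1)) : ℝ) + ((p.eval (-1) : ℚ) : ℝ) := by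
  have hXC : (Polynomial.X - Polynomial.C (-1 : ℚ) : ℚ[X]) = Polynomial.X + 1 := by
    rw [map_neg, map_one, sub_neg_eq_add]
  have h := Polynomial.modByMonic_add_div p (Polynomial.X + 1 : ℚ[X])
  rw [← hXC, Polynomial.modByMonic_X_sub_C_eq_C_eval, hXC] at h
  have h' := congrArg (Polynomial.aeval u) h
  simp only [map_add, map_mul, map_one, Polynomial.aeval_X, Polynomial.aeval_C, eq_ratCast] at h'
  rw [← h']
  ring

/-- `u^b Σ_{i<n} u^i = (u + 1)·s(u) + ρ` with `s = (X^b Σ_{i<n} X^i) /ₘ (X + 1) ∈ ℚ[X]` and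
`ρ = (−1)^b Σ_{i<n} (−1)^i ∈ ℚ`. [folklore] -/
theorem lt2_geom_div (b n : ℕ) (u : ℝ) :
    u ^ b * ∑ i ∈ Finset.range n, u ^ i =
      (u + 1) * (Polynomial.aeval u ((Polynomial.X ^ b * ∑ i ∈ Finset.range n, Polynomial.X ^ i :
        ℚ[X]) /ₘ (Polynomial.X + 1)) : ℝ) +
      (((Polynomial.X ^ b * ∑ i ∈ Finset.range n, Polynomial.X ^ i : ℚ[X]).eval (-1) : ℚ) : ℝ) := by
  rw [← lt2_aeval_eq_divByMonic]
  simp [map_mul, map_pow, map_sum]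

/-- For an even number of terms the remainder vanishes: `(−1)^b Σ_{i<2m} (−1)^i = 0`. [folklore] -/
theorem lt2_eval_neg_one_even (b m : ℕ) :
    ((Polynomial.X ^ b * ∑ i ∈ Finset.range (2 * m), Polynomial.X ^ i : ℚ[X]).eval (-1) : ℚ) = 0 := by
  simp only [Polynomial.eval_mul, Polynomial.eval_pow, Polynomial.eval_X, Polynomial.eval_finsetSum,
    neg_one_geom_sum, if_pos (even_two_mul m), mul_zero]

/-- The pointwise splitting of the integrand off the pole `u = −1`:
`a((u+1)A + r)/(1+u) = aA + ar/(1+u)`. [folklore] -/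
theorem lt2_split_identity (a A r u : ℝ) (hu : 1 + u ≠ 0) :
    a * ((u + 1) * A + r) / (1 + u) = a * A + a * r / (1 + u) := by
  field_simp
  ring

/-! ### The two intermediate representations exist -/

/-- **The polynomial box `[(0,1), a·s(u)]` exists** for `a` real algebraic and `s ∈ ℚ[X]`
(an algebraic constant times a `ℚ`-polynomial is `ℚ`-semialgebraic; continuous on `[0,1]`).
[cite: KontsevichZagier2001, §1.1] -/
theorem lt2_exists_polyRepA {a : ℝ} (ha : IsAlgebraic ℚ a) (s : ℚ[X]) :
    ∃ P : IntegralRep 1, P.domain = {x | ∀ i, x i ∈ Set.Ioo (0:ℝ) 1} ∧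
      P.integrand = fun x => a * (Polynomial.aeval (x 0) s : ℝ) := by
  have hB := isSemialgebraic_box 1
  have hsa : IsSemialgebraicFunOn ℚ {x : Fin 1 → ℝ | ∀ i, x i ∈ Set.Ioo (0:ℝ) 1}
      (fun x => a * (Polynomial.aeval (x 0) s : ℝ)) :=
    (IsSemialgebraicFunOn.mul_holds (isSemialgebraicFunOn_const_of_isAlgebraic hB ha)
      (Dlog.isSemialgebraicFunOn_polynomial_div hB s 1 fun x _ => by simp)).congr fun x _ => by
      simp
  have hcont : Continuous fun x : Fin 1 → ℝ => a * (Polynomial.aeval (x 0) s : ℝ) :=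
    continuous_const.mul ((Polynomial.continuous_aeval s).comp (continuous_apply 0))
  have hint : IntegrableOn (fun x : Fin 1 → ℝ => a * (Polynomial.aeval (x 0) s : ℝ))
      {x | ∀ i, x i ∈ Set.Ioo (0:ℝ) 1} :=
    hcont.integrableOn_Icc.mono_set fun _ hx => ⟨fun j => (hx j).1.le, fun j => (hx j).2.le⟩
  exact ⟨⟨_, _, hB, hsa, hint⟩, rfl, rfl⟩

/-- **The simple-pole box `[(0,1), γ/(1 + u)]` exists** for `γ` real algebraic (the pole `u = −1`
is off `[0,1]`, so the integrand is continuous on the compact slab). [cite: KontsevichZagier2001, §1.1] -/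
theorem lt2_exists_invRepA {γ : ℝ} (hγ : IsAlgebraic ℚ γ) :
    ∃ C : IntegralRep 1, C.domain = {x | ∀ i, x i ∈ Set.Ioo (0:ℝ) 1} ∧
      C.integrand = fun x => γ / (1 + x 0) := by
  have hB := isSemialgebraic_box 1
  have hsa : IsSemialgebraicFunOn ℚ {x : Fin 1 → ℝ | ∀ i, x i ∈ Set.Ioo (0:ℝ) 1}
      (fun x => γ / (1 + x 0)) :=
    (isSemialgebraicFunOn_const_of_isAlgebraic hB hγ).div
      ((isSemialgebraicFunOn_aeval hB (1 + MvPolynomial.X 0 : MvPolynomial (Fin 1) ℚ)).congr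
        fun x _ => by simp)
      fun x hx => (add_pos one_pos (hx 0).1).ne'
  have hsub : {x : Fin 1 → ℝ | ∀ i, x i ∈ Set.Ioo (0:ℝ) 1} ⊆ Set.Icc (0 : Fin 1 → ℝ) 1 :=
    fun _ hx => ⟨fun j => (hx j).1.le, fun j => (hx j).2.le⟩
  have hcont : ContinuousOn (fun x : Fin 1 → ℝ => γ / (1 + x 0)) (Set.Icc (0 : Fin 1 → ℝ) 1) :=
    continuousOn_const.div (by fun_prop : Continuous fun x : Fin 1 → ℝ => 1 + x 0).continuousOn
      fun x hx => by
        have h0 : (0 : Fin 1 → ℝ) 0 ≤ x 0 := hx.1 0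
        simp only [Pi.zero_apply] at h0
        exact (add_pos_of_pos_of_nonneg one_pos h0).ne'
  have hint : IntegrableOn (fun x : Fin 1 → ℝ => γ / (1 + x 0)) {x | ∀ i, x i ∈ Set.Ioo (0:ℝ) 1} :=
    (hcont.integrableOn_compact isCompact_Icc).mono_set hsub
  exact ⟨⟨_, _, hB, hsa, hint⟩, rfl, rfl⟩

/-! ### The two moves -/

/-- **The polynomial box is an algebraic point** (rule 3): for `a` real algebraic, `s, G ∈ ℚ[X]`
with `G' = s`, `[(0,1), a·s(u)] − [pt, a (G(1) − G(0))] ∈ relations` — ONE Newton–Leibniz move over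
the point with algebraic ends (`SlabAK20.slabA_sub_pt_mem_relations`), primitive `a·G`.
[cite: KontsevichZagier2001, §1.2 rule (3)] -/
theorem lt2_polyRep_sub_pt_mem_relations {a : ℝ} (ha : IsAlgebraic ℚ a) (s G : ℚ[X])
    (hG : ∀ t : ℝ, HasDerivAt (fun u : ℝ => (Polynomial.aeval u G : ℝ)) (Polynomial.aeval t s) t)
    (P : IntegralRep 1) (hPd : P.domain = {x | ∀ i, x i ∈ Set.Ioo (0:ℝ) 1})
    (hPi : P.integrand = fun x => a * (Polynomial.aeval (x 0) s : ℝ))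
    (Z : IntegralRep 0) (hZd : Z.domain = Set.univ)
    (hZi : Z.integrand = fun _ => a * algebraMap ℚ ℝ (G.eval 1 - G.eval 0)) :
    of P - of Z ∈ relations := by
  have hK : IsSemialgebraic ℚ {x : Fin 1 → ℝ | x 0 ∈ Set.Icc (0:ℝ) 1} :=
    SlabAK20.isSemialgebraic_setOf_apply_mem_Icc_of_isAlgebraic isAlgebraic_zero isAlgebraic_one 0
  -- `a` times a `ℚ`-polynomial is `ℚ`-semialgebraic on the closed slab
  have hpoly : ∀ A : ℚ[X], IsSemialgebraicFunOn ℚ {x : Fin 1 → ℝ | x 0 ∈ Set.Icc (0:ℝ) 1}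
      (fun x => (fun t : ℝ => a * (Polynomial.aeval t A : ℝ)) (x 0)) := fun A =>
    (IsSemialgebraicFunOn.mul_holds (isSemialgebraicFunOn_const_of_isAlgebraic hK ha)
      (Dlog.isSemialgebraicFunOn_polynomial_div hK A 1 fun x _ => by simp)).congr fun x _ => by
      simp
  have hPd' : P.domain = {x | x 0 ∈ Set.Ioo (0:ℝ) 1} := by
    rw [hPd]
    exact Set.ext fun x => Fin.forall_fin_one
  have e1 : (Polynomial.aeval (1:ℝ) G : ℝ) = algebraMap ℚ ℝ (G.eval 1) := by
    rw [← Polynomial.aeval_algebraMap_apply_eq_algebraMap_eval, map_one]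
  have e0 : (Polynomial.aeval (0:ℝ) G : ℝ) = algebraMap ℚ ℝ (G.eval 0) := by
    rw [← Polynomial.aeval_algebraMap_apply_eq_algebraMap_eval, map_zero]
  have hZi' : Z.integrand = fun _ =>
      a * (Polynomial.aeval (1:ℝ) G : ℝ) - a * (Polynomial.aeval (0:ℝ) G : ℝ) := by
    rw [hZi, e1, e0, map_sub]
    funext
    ring
  exact SlabAK20.slabA_sub_pt_mem_relations isAlgebraic_zero isAlgebraic_one zero_le_one
    (fun t : ℝ => a * (Polynomial.aeval t s : ℝ)) (fun t : ℝ => a * (Polynomial.aeval t G : ℝ))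
    (hpoly G) ((continuous_const.mul (Polynomial.continuous_aeval G)).continuousOn)
    (fun t _ => (hG t).const_mul a) (hpoly s) P hPd' (by rw [hPi]; exact fun _ _ => rfl) Z hZd hZi'

/-- **The simple-pole box is the carrier `Λ(2, γ)`** (rule 2): the shift `y = 1 + u` carries
`[(0,1), γ/(1 + u)]` onto `[(1,2), γ/y]` (`AlgSplitK5.pole_neg_sub_carrier_mem_relations` at the
pole `−1`, `1 − 1/(−1) = 2`). [cite: KontsevichZagier2001, §1.2 rule (2)] -/
theorem lt2_invRep_sub_carrier_mem_relations (γ : ℝ) (C L : IntegralRep 1)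
    (hCd : C.domain = {x | ∀ i, x i ∈ Set.Ioo (0:ℝ) 1}) (hCi : C.integrand = fun x => γ / (1 + x 0))
    (hLd : L.domain = {x : Fin 1 → ℝ | x 0 ∈ Set.Ioo (1:ℝ) 2})
    (hLi : L.integrand = fun x => γ / x 0) : of C - of L ∈ relations := by
  refine AlgSplitK5.pole_neg_sub_carrier_mem_relations (ρ := -1) isAlgebraic_one.neg (by norm_num)
    C L (by rw [hCd]; exact Set.ext fun x => Fin.forall_fin_one)
    (fun x _ => by rw [hCi]; dsimp only; rw [sub_neg_eq_add, add_comm]) ?_ hLi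
  rw [hLd]
  norm_num

/-! ### The splitting, for an abstract division with remainder -/

/-- **The dimension-one endgame for an abstract division `u^b Σ_{i<n} u^i = (u+1) s(u) + ρ`**
(`s ∈ ℚ[X]`, `ρ ∈ ℚ`): for `c` real algebraic, `cρ/n` is algebraic and there is an algebraic `q` with
`N₁ − Λ(2, cρ/n) − [pt, q] ∈ relations` for every carrier `Λ(2, cρ/n) = [(1,2), (cρ/n)/y]` and
every point `[pt, q]` — integrand additivity (rule 1) into the polynomial box (→ point, rule 3)
and the simple-pole box (→ carrier, rule 2). [cite: KontsevichZagier2001, §1.2 rules (1)–(3)] -/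
theorem lt2_dimOne_split_of_div (c : ℝ) (hc : IsAlgebraic ℚ c) (b n : ℕ) (s : ℚ[X]) (ρ : ℚ)
    (hdiv : ∀ u : ℝ, u ^ b * ∑ i ∈ Finset.range n, u ^ i =
      (u + 1) * (Polynomial.aeval u s : ℝ) + (ρ : ℝ))
    (N₁ : IntegralRep 1) (hN₁d : N₁.domain = {x | ∀ i, x i ∈ Set.Ioo (0:ℝ) 1})
    (hN₁i : EqOn N₁.integrand
      (fun x => c / (n : ℝ) * (x 0 ^ b * ∑ i ∈ Finset.range n, x 0 ^ i) / (1 + x 0)) N₁.domain) :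
    IsAlgebraic ℚ (c / (n : ℝ) * (ρ : ℝ)) ∧ ∃ q : ℝ, IsAlgebraic ℚ q ∧
      ∀ (L : IntegralRep 1) (Z : IntegralRep 0),
        L.domain = {x : Fin 1 → ℝ | x 0 ∈ Set.Ioo (1:ℝ) 2} →
        (L.integrand = fun x => c / (n : ℝ) * (ρ : ℝ) / x 0) →
        Z.domain = Set.univ → (Z.integrand = fun _ => q) → of N₁ - of L - of Z ∈ relations := by
  have ha : IsAlgebraic ℚ (c / (n : ℝ)) := by
    rw [div_eq_mul_inv]
    exact hc.mul (isAlgebraic_nat n).inv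
  have hγ : IsAlgebraic ℚ (c / (n : ℝ) * (ρ : ℝ)) := ha.mul (isAlgebraic_algebraMap ρ)
  obtain ⟨G, hG⟩ := Dlog.exists_polynomial_hasDerivAt s
  obtain ⟨P, hPd, hPi⟩ := lt2_exists_polyRepA ha s
  obtain ⟨C, hCd, hCi⟩ := lt2_exists_invRepA hγ
  refine ⟨hγ, c / (n : ℝ) * algebraMap ℚ ℝ (G.eval 1 - G.eval 0),
    ha.mul (isAlgebraic_algebraMap _), fun L Z hLd hLi hZd hZi => ?_⟩
  -- (1) integrand additivity on the box: `N₁ = P + C`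
  have h1 : of N₁ - of P - of C ∈ relations := by
    refine integrandAddRel_subset_relations
      ⟨1, N₁, P, C, hPd.trans hN₁d.symm, hCd.trans hN₁d.symm, fun x hx => ?_, rfl⟩
    have hx0 : 0 < x 0 := by
      rw [hN₁d] at hx
      exact (hx 0).1
    rw [hN₁i hx, Pi.add_apply, hPi, hCi]
    dsimp only
    rw [hdiv (x 0)]
    exact lt2_split_identity _ _ _ _ (add_pos one_pos hx0).ne'
  -- (3) the polynomial box is the point `[pt, q]`
  have h2 : of P - of Z ∈ relations :=
    lt2_polyRep_sub_pt_mem_relations ha s G hG P hPd hPi Z hZd hZi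
  -- (2) the simple-pole box is the carrier `Λ(2, cρ/n)`
  have h3 : of C - of L ∈ relations :=
    lt2_invRep_sub_carrier_mem_relations _ C L hCd hCi hLd hLi
  have e : of N₁ - of L - of Z = (of N₁ - of P - of C) + (of P - of Z) + (of C - of L) := by abel
  rw [e]
  exact relations.add_mem (relations.add_mem h1 h2) h3

/-! ### The stub -/

/-- **Stub T3 (dimension one to the normal form `Λ(2, γ) + [pt, q]`, rules 1 + 2 + 3).** For `c`
real algebraic and `N₁ = [(0,1), (c/n) u^b (Σ_{i<n} u^i)/(1 + u)]`: (1) there are real algebraic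
`γ, q` with `N₁ − Λ(2, γ) − [pt, q] ∈ relations` for every carrier `Λ(2, γ) = [(1,2), γ/y]` and
every point `[pt, q]` (division with remainder by `1 + u`, the polynomial box to a point by
Newton–Leibniz, the simple-pole box to the carrier by the shift `y = 1 + u`); (2) when the number
of terms `n = 2m` is even the remainder `γ` vanishes and `N₁ − [pt, q] ∈ relations`.
[cite: KontsevichZagier2001, §1.2 rules (1)–(3)] -/
theorem levelTwo_dimOne_normalForm (c : ℝ) (hc : IsAlgebraic ℚ c) :
    (∀ (b n : ℕ), 0 < n → ∀ (N₁ : IntegralRep 1),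
      N₁.domain = {x | ∀ i, x i ∈ Set.Ioo (0:ℝ) 1} →
      EqOn N₁.integrand
        (fun x => c / (n : ℝ) * (x 0 ^ b * ∑ i ∈ Finset.range n, x 0 ^ i) / (1 + x 0)) N₁.domain →
      ∃ γ q : ℝ, IsAlgebraic ℚ γ ∧ IsAlgebraic ℚ q ∧ ∀ (L : IntegralRep 1) (Z : IntegralRep 0),
        L.domain = {x : Fin 1 → ℝ | x 0 ∈ Set.Ioo (1:ℝ) 2} → (L.integrand = fun x => γ / x 0) →
        Z.domain = Set.univ → (Z.integrand = fun _ => q) → of N₁ - of L - of Z ∈ relations) ∧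
    (∀ (b m : ℕ), 0 < m → ∀ (N₁ : IntegralRep 1),
      N₁.domain = {x | ∀ i, x i ∈ Set.Ioo (0:ℝ) 1} →
      EqOn N₁.integrand
        (fun x => c / ((2 * m : ℕ) : ℝ) * (x 0 ^ b * ∑ i ∈ Finset.range (2 * m), x 0 ^ i) / (1 + x 0))
        N₁.domain →
      ∃ q : ℝ, IsAlgebraic ℚ q ∧ ∀ (Z : IntegralRep 0),
        Z.domain = Set.univ → (Z.integrand = fun _ => q) → of N₁ - of Z ∈ relations) := by
  refine ⟨fun b n _ N₁ hN₁d hN₁i => ?_, fun b m _ N₁ hN₁d hN₁i => ?_⟩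
  · -- conjunct 1: `γ = (c/n)·ρ`, `ρ = (−1)^b Σ_{i<n} (−1)^i`
    obtain ⟨hγ, q, hq, h⟩ :=
      lt2_dimOne_split_of_div c hc b n _ _ (lt2_geom_div b n) N₁ hN₁d hN₁i
    exact ⟨_, q, hγ, hq, h⟩
  · -- conjunct 2: the remainder vanishes, the carrier `[(1,2), 0/y]` is a relation
    obtain ⟨-, q, hq, h⟩ :=
      lt2_dimOne_split_of_div c hc b (2 * m) _ _ (lt2_geom_div b (2 * m)) N₁ hN₁d hN₁i
    obtain ⟨R, hR⟩ := Dlog.exists_carrierA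
    have h2 : IsAlgebraic ℚ (2:ℝ) := by exact_mod_cast (isAlgebraic_nat 2 : IsAlgebraic ℚ ((2:ℕ):ℝ))
    have hL := hR 1 2 0 isAlgebraic_one h2 isAlgebraic_zero one_pos
    refine ⟨q, hq, fun Z hZd hZi => ?_⟩
    have h1 : of N₁ - of (R 1 2 0) - of Z ∈ relations := by
      refine h (R 1 2 0) Z hL.1 ?_ hZd hZi
      rw [hL.2, lt2_eval_neg_one_even]
      funext x
      simp
    have h0 : of (R 1 2 0) ∈ relations := Dlog.carrierA_zero_mem_relations hR h2
    have e : of N₁ - of Z = (of N₁ - of (R 1 2 0) - of Z) + of (R 1 2 0) := by abel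
    rw [e]
    exact relations.add_mem h1 h0

end Summit.KontsevichZagierPeriods.HurwitzMicroSectors.NormalFormPrinciple.PiBox.AlgLevelTwo
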